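/-
Copyright (c) 2026 the pub-hodgecm-mathlib formalisation cell (harness21).  Prover seat hodgecm-mathlib-R90-C133-p03 (g2) (free S5 hand spilled to S8; deal S8-R54 (β)
2026-09-04T22:35:02Z on the (KF) census `R90/R90-C133-p03/g2/CENSUS-KF.md`), Track B ∕ K2-LIT, h413 = `stmt-HodgeConjecture-24833`, R90-TF section S8 «ContSpec-n½»:
the TOP letter of the #2 chain in REPRESENTATION-THEORETIC form — «if every irreducible closed subrepresentation of the top-residue space is one-dimensional, the
top-residue space lies in the closed span of the character lines `ℂ·[ψ̄∘det]`» — and the G-print of ★ F1_qs with its (L₃)-top letter so discharged.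
-/
import Summits.HodgeConjecture.HodgeConjecture.Theorems.R90S8ResGLeClosureOfLettersU3                 -- ★ p862541 (this seat): F1 ∕ F1_qs `residualG_le_topologicalClosure_of_letters(_quasiSplit)`; brings ★ p862066, ★ `residualSubspace(_le_discreteSpectrum)`, `quasiSplit`
import Summits.HodgeConjecture.HodgeConjecture.Theorems.R90S8CharLineOfOneDim                         -- ★ `cm_exists_eq_cmDetChar_of_eq_antidiagonal_three` (every automorphic character of `U(J₃)(𝔸)` is a `cmDetChar`); brings ★ `exists_eq_ofChar_of_isOneDimensional`, ★ `ofChar_space`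
import Literature.NumberTheory.Automorphic.AutomorphicRepsGLCuspidalSpectralExpansion                  -- ★ `ClosedSubrep.le_of_forall_isTopIrreducible_le`, ★ `ClosedSubrep.isDiscretelyDecomposable_toContRep_of_le`
import Literature.NumberTheory.Automorphic.HilbertRepDiscretePart                                      -- ★ `isDiscretelyDecomposable_discretePart`
import HarnessLib

/-!
# S8 #2 road — `R90S8TopResidueCharLineOfOneDimQuotient`: the TOP letter in representation-theoretic form, and ★ F1_qs with it
# («irreducibles of the top-residue space are ONE-DIMENSIONAL ⟹ top residues lie in `closure ⨆_ψ ℂ·[ψ̄∘det]`»)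

Track B ∕ K2-LIT, crux h413 = `stmt-HodgeConjecture-24833`, route of record `HCCMUnconditional`; cell `hodgecm-mathlib`, R90-TF programme, section S8 «ContSpec-n½», socket #2
`sock_S8_res_classification` of `Lines/R90_S8_ResidualSpectrumU3B.lean`.  THEOREMS ONLY (no `def`, no `instance`, no `notation`, no named-fact hypothesis, no `sorry`; default
heartbeats); lane `--supports stmt-HodgeConjecture-24833 --as helper` (count-neutral).  CLOSES NO SOCKET.

WHY (the (KF) census, dealer ruling S8-R54): the (L₃) letter of ★ F1_qs `residualG_le_topologicalClosure_of_letters_quasiSplit` asks that the TOP-pole residue atoms lie in the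
character-line lattice.  ★ F6 (`K2E1ChiEisensteinTopResidueCharLineU3`) pays it for the twisted SPHERICAL sections; for K-finite non-spherical sections (KF) the content is «the
residue of the intertwining operator at the top pole is rank one onto the constants», whose print roads are (A) the unique irreducible quotient `χ₂∘det` of the unramified principal
series at the top exponent at EVERY place [Rogawski1990 §12.2 (1) p. 173 (non-split, ★ S1 A3 in tree); Zelevinsky1980 Thm. 6.1 (split `GL₃`); BorelWallach2000 IV (archimedean)],
(B) one non-split place + strong approximation for `SU(J₃)` [PlatonovRapinchuk1994 Thm. 7.12], (C) Gindikin–Karpelevich on `K`-types — none typed tonight.  ALL THREE prove the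
SAME representation-theoretic sentence: «every irreducible closed subrepresentation of the top-residue space `A_top ≤ L²_res(U(J₃))` is ONE-DIMENSIONAL» [Rogawski1990 §13.3 ¶1
p. 202: «the one-dimensional representations … occur in the residual spectrum»; §13.9 (i) p. 229].  THIS FILE takes that sentence as the letter (TOP) and proves the lattice
consequence (β) by Hilbert-space means, for ALL `K`-types and ALL blocks at once:
* §1 (generic unitary `π` on a Hilbert space) **`toSubmodule_le_topologicalClosure_iSup_of_forall_irreducible`** — a closed subrepresentation `A ≤ π.discretePart` all of whose
  irreducible closed subrepresentations lie in members of a family `Λ` lies in `closure (⨆ Λ)` (★ `le_of_forall_isTopIrreducible_le` ∘ ★ `isDiscretelyDecomposable_toContRep_of_le`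
  ∘ ★ `isDiscretelyDecomposable_discretePart`, at `Z := iSupClosure (range Λ)`). [Dixmier1977 §5.4, §13.1.5]
* §2 (Mok's carrier `quasiSplit L⁺ L c 3`) **`le_topologicalClosure_iSup_lineSubrep_of_forall_isOneDimensional`** — (TOP) ⟹ `A_top ≤ closure ⨆_ψ ℂ·[ψ̄∘det]` in ★ F6's∕F1_qs's
  lattice BYTES (`lineSubrep (cmDetChar L 3 ((antidiagonal 3).over L) ψ.1 ψ.2 _) μ`): a one-dimensional discrete automorphic representation is `ofChar Θ` (★
  `exists_eq_ofChar_of_isOneDimensional`) and `Θ = cmDetChar … θ` (★ `cm_exists_eq_cmDetChar_of_eq_antidiagonal_three`: Dieudonné's transvections kill `SU(J₃)(𝔸)`).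
* §3 **`residualG_le_topologicalClosure_of_top_quasiSplit`** — ★ F1_qs WITH ITS TOP LETTER IN THIS FORM: the (L₃) binder `hL : At i b ≤ (⨆ lines) ⊔ ⨆ Bn` is replaced by
  `hL : At i b ≤ A_top ⊔ ⨆ Bn` plus (TOP) on `A_top` (any closed subrepresentation `≤ L²_disc`, e.g. the G-DEFS carrier `resGTopAtoms` of K2E1-p11); conclusion = F1_qs's bytes
  (★ p862066 at `C := closure (⨆ lines) ⊔ ⨆ Bn`, then `closure (closure L ⊔ X) ≤ closure (L ⊔ X)`).  B ED. 5's #2 line then reads ★ F3 ∘ ★ F2_qs ∘ §3 modulo {EXH, TOP, MID}.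
HONEST LABEL: HC_CM is proved only modulo the 7 printed citations (2 remaining named inputs: hLiu418 = `stmt-HodgeConjecture-24832`, h413 = `stmt-HodgeConjecture-24833`) until
rung 0 closes; REL ≠ ★ ≠ BUILT; this file asserts no named fact, is conditional by construction on its visible binders ((TOP) is a LETTER = the new DAG row S8-B#2-TOP, child of R1₃),
and closes no socket; count-neutral.

## References
* [Rogawski1990] J. D. Rogawski, *Automorphic Representations of Unitary Groups in Three Variables* (1990), §13.3 ¶1 p. 202, §13.9 (i)–(ii) p. 229, §12.2 (1) p. 173.
* [MoeglinWaldspurger1995] C. Mœglin, J.-L. Waldspurger, *Spectral Decomposition and Eisenstein Series* (1995), I.2.18, IV.1.11, V.3.13.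
* [Langlands1976] R. P. Langlands, *On the Functional Equations Satisfied by Eisenstein Series*, LNM 544 (1976), §7.
* [Dixmier1977] J. Dixmier, *C\*-algebras* (1977), §5.4, §13.1.5.  [BorelJacquet1979] A. Borel, H. Jacquet, Corvallis (1979), §4.6.
* [Zelevinsky1980] A. Zelevinsky, *Induced representations of reductive p-adic groups II*, Ann. Sci. ÉNS 13 (1980), Thm. 6.1.  [PlatonovRapinchuk1994] Thm. 7.12.
-/

set_option autoImplicit false
set_option linter.dupNamespace false  -- the mandated namespace `…HodgeConjecture.HodgeConjecture.R90.S8` (LEAD #1 L1) repeats the summit's segment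

noncomputable section

open MeasureTheory NumberField
open Literature.NumberTheory.Automorphic.Arthur2013.Leaves.TECR
open Literature.NumberTheory.Automorphic Literature.NumberTheory.Automorphic.UnitaryGroup
open Literature.NumberTheory.Rogawski1990
open Summit.HodgeConjecture.HodgeConjecture.Cruxes.H413.K2E1CuspidalSpectrumUnitary (residualSubspace residualSubspace_le_discreteSpectrum)

namespace Summit.HodgeConjecture.HodgeConjecture.R90.S8

open ContRepresentation

/-! ## §1 Generic: a closed subrepresentation of the discrete part whose irreducibles lie in a family lies in the closed span of the family -/

section Generic

variable {G H : Type*} [Group G] [NormedAddCommGroup H] [InnerProductSpace ℂ H] [CompleteSpace H] {π : ContRepresentation ℂ G H}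

/-- **Irreducibles in the family ⟹ the whole (discrete) subrepresentation in its closed span.**  For `π` unitary, a closed subrepresentation `A ≤ π.discretePart` and a family
`Λ : ι → ClosedSubrep π`: if every topologically irreducible closed `W ≤ A` lies in some `Λ i`, then `A ≤ closure (⨆ i, Λ i)` — `A` is discretely decomposable (★
`isDiscretelyDecomposable_toContRep_of_le` ∘ ★ `isDiscretelyDecomposable_discretePart`), so ★ `le_of_forall_isTopIrreducible_le` applies with the closed span `iSupClosure (range Λ)`.
[cite: Dixmier1977, §5.4, §13.1.5] -/
theorem toSubmodule_le_topologicalClosure_iSup_of_forall_irreducible (hπ : π.IsUnitary) (A : ClosedSubrep π) (hA : A ≤ π.discretePart)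
    {ι : Type*} (Λ : ι → ClosedSubrep π) (h : ∀ W : ClosedSubrep π, W ≤ A → W.toContRep.IsTopIrreducible → ∃ i, W ≤ Λ i) :
    A.toSubmodule ≤ (⨆ i, (Λ i).toSubmodule).topologicalClosure := by
  have hdd : A.toContRep.IsDiscretelyDecomposable :=
    ClosedSubrep.isDiscretelyDecomposable_toContRep_of_le hπ (isDiscretelyDecomposable_discretePart (π := π)) hA
  have key : A ≤ ClosedSubrep.iSupClosure (Set.range Λ) :=
    ClosedSubrep.le_of_forall_isTopIrreducible_le hdd _ fun W hWA hW => by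
      obtain ⟨i, hi⟩ := h W hWA hW
      exact hi.trans (ClosedSubrep.le_iSupClosure ⟨i, rfl⟩)
  have hrange : (⨆ W ∈ Set.range Λ, (W : ClosedSubrep π).toSubmodule) = ⨆ i, (Λ i).toSubmodule := iSup_range
  intro v hv
  have hv' : v ∈ (⨆ W ∈ Set.range Λ, (W : ClosedSubrep π).toSubmodule).topologicalClosure := key hv
  rwa [hrange] at hv'

end Generic

/-! ## §2 Mok's carrier `U(J₃) = quasiSplit L⁺ L c 3`: (TOP) ⟹ the top-residue space lies in the closed span of the character lines -/

section QuasiSplit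

variable (L : Type) [Field L] [NumberField L] [IsCMField L]
  (μq : Measure (quasiSplit (↥(maximalRealSubfield L)) L (IsCMField.complexConj L) 3).automorphicQuotient)
  [(quasiSplit (↥(maximalRealSubfield L)) L (IsCMField.complexConj L) 3).IsAutomorphicMeasure μq]

/-- **(β) — THE TOP LETTER IN REPRESENTATION-THEORETIC FORM GIVES THE LINE LATTICE.**  For any closed subrepresentation `A ≤ L²_disc(U(J₃))` (e.g. the closed span of the
TOP-pole residue classes): if every discrete automorphic representation `P` with `P.space ≤ A` is ONE-DIMENSIONAL (letter (TOP) [Rogawski1990 §13.3 ¶1]), then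
`A ≤ closure (⨆_ψ ℂ·[ψ̄∘det])` in ★ F6's∕F1_qs's lattice bytes — each irreducible `W ≤ A` is `ofChar Θ` (★ `exists_eq_ofChar_of_isOneDimensional`) and `Θ = cmDetChar L 3 J₃ θ`
(★ `cm_exists_eq_cmDetChar_of_eq_antidiagonal_three`), so §1 applies.  Valid for ALL `K`-types and ALL blocks at once.
[cite: Rogawski1990, §13.3 p. 202; §13.9 p. 229 (i)] [cite: BorelJacquet1979, §4.6] [cite: Dixmier1977, §5.4] -/
theorem le_topologicalClosure_iSup_lineSubrep_of_forall_isOneDimensional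
    (A : ClosedSubrep ((quasiSplit (↥(maximalRealSubfield L)) L (IsCMField.complexConj L) 3).rightRegular μq))
    (hA : A ≤ (quasiSplit (↥(maximalRealSubfield L)) L (IsCMField.complexConj L) 3).discreteSpectrum μq)
    (h1 : ∀ P : DiscreteAutomorphicRep (quasiSplit (↥(maximalRealSubfield L)) L (IsCMField.complexConj L) 3) μq, P.space ≤ A → P.IsOneDimensional) :
    A.toSubmodule ≤
      (⨆ ψ : {ψ : ↥(TorusDict.torus (IsCMField.complexConj L)) →ₜ* ℂˣ // TorusDict.IsAutomorphic (IsCMField.complexConj L) ψ},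
        (AdelicGroupData.AutomorphicCharacter.lineSubrep (𝒢 := (quasiSplit (↥(maximalRealSubfield L)) L (IsCMField.complexConj L) 3))
          (cmDetChar L 3 ((StdForm.antidiagonal 3).over L) ψ.1 ψ.2 ((Matrix.isUnit_iff_isUnit_det _).mp (StdForm.isUnit_over (StdForm.antidiagonal 3) L)).ne_zero) μq).toSubmodule).topologicalClosure := by
  -- the topological instances of `U(J₃)(𝔸)` (★ `cmDatum` instances; `quasiSplit … 3 = cmDatum L 3 J₃` by `rfl`)
  haveI : LocallyCompactSpace (quasiSplit (↥(maximalRealSubfield L)) L (IsCMField.complexConj L) 3).Adelic :=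
    UnitaryGroup.locallyCompactSpace_cmDatum_Adelic L 3 ((StdForm.antidiagonal 3).over L)
  haveI : SecondCountableTopology (quasiSplit (↥(maximalRealSubfield L)) L (IsCMField.complexConj L) 3).Adelic :=
    UnitaryGroup.secondCountableTopology_cmDatum_Adelic L 3 ((StdForm.antidiagonal 3).over L)
  refine toSubmodule_le_topologicalClosure_iSup_of_forall_irreducible
    ((quasiSplit (↥(maximalRealSubfield L)) L (IsCMField.complexConj L) 3).isUnitary_rightRegular μq) A hA _ fun W hWA hW => ?_
  obtain ⟨Θ, hΘ⟩ := DiscreteAutomorphicRep.exists_eq_ofChar_of_isOneDimensional μq ⟨W, hW⟩ (h1 ⟨W, hW⟩ hWA)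
  obtain ⟨θ, hθ, hΘθ⟩ := cm_exists_eq_cmDetChar_of_eq_antidiagonal_three L ((StdForm.antidiagonal 3).over L) rfl
    ((Matrix.isUnit_iff_isUnit_det _).mp (StdForm.isUnit_over (StdForm.antidiagonal 3) L)).ne_zero Θ
  refine ⟨⟨θ, hθ⟩, ?_⟩
  have hsp : W = (DiscreteAutomorphicRep.ofChar Θ μq).space := congrArg DiscreteAutomorphicRep.space hΘ
  rw [hsp, DiscreteAutomorphicRep.ofChar_space, ← hΘθ]

/-- The same under the natural hypothesis `A ≤ L²_res(U(J₃), 𝔓)` (★ `residualSubspace_le_discreteSpectrum`). [cite: MoeglinWaldspurger1995, I.2.18] [cite: Rogawski1990, §13.3 p. 202] -/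
theorem le_topologicalClosure_iSup_lineSubrep_of_forall_isOneDimensional_of_le_residual
    (𝔓 : (quasiSplit (↥(maximalRealSubfield L)) L (IsCMField.complexConj L) 3).ParabolicUnipotentData)
    (A : ClosedSubrep ((quasiSplit (↥(maximalRealSubfield L)) L (IsCMField.complexConj L) 3).rightRegular μq))
    (hA : A ≤ residualSubspace (quasiSplit (↥(maximalRealSubfield L)) L (IsCMField.complexConj L) 3) μq 𝔓)
    (h1 : ∀ P : DiscreteAutomorphicRep (quasiSplit (↥(maximalRealSubfield L)) L (IsCMField.complexConj L) 3) μq, P.space ≤ A → P.IsOneDimensional) :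
    A.toSubmodule ≤
      (⨆ ψ : {ψ : ↥(TorusDict.torus (IsCMField.complexConj L)) →ₜ* ℂˣ // TorusDict.IsAutomorphic (IsCMField.complexConj L) ψ},
        (AdelicGroupData.AutomorphicCharacter.lineSubrep (𝒢 := (quasiSplit (↥(maximalRealSubfield L)) L (IsCMField.complexConj L) 3))
          (cmDetChar L 3 ((StdForm.antidiagonal 3).over L) ψ.1 ψ.2 ((Matrix.isUnit_iff_isUnit_det _).mp (StdForm.isUnit_over (StdForm.antidiagonal 3) L)).ne_zero) μq).toSubmodule).topologicalClosure :=
  le_topologicalClosure_iSup_lineSubrep_of_forall_isOneDimensional L μq A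
    (hA.trans (residualSubspace_le_discreteSpectrum (quasiSplit (↥(maximalRealSubfield L)) L (IsCMField.complexConj L) 3) μq 𝔓)) h1

/-! ## §3 ★ F1_qs with its (L₃)-top letter in the form (TOP) -/

/-- **LAYER 2 G-PRINT ON MOK'S CARRIER WITH THE TOP LETTER (TOP)** — ★ F1_qs `residualG_le_topologicalClosure_of_letters_quasiSplit` with its (L₃) binder split into
`hL : At i b ≤ A_top ⊔ ⨆_k Bn k` (atoms are top atoms or lie in the middle blocks) and the representation-theoretic TOP letter `h1` on the closed subrepresentation
`A_top ≤ L²_disc` (the G-DEFS carrier of the top-pole residue classes): the conclusion is F1_qs's, byte for byte (`P ≤ closure ((⨆_ψ ℂ·[ψ̄∘det]) ⊔ (⨆_k Bn k))`).  Proof: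
★ p862066 at `C := closure (⨆ lines) ⊔ ⨆ Bn` (§2 feeds `hL`), then `closure (closure L ⊔ X) ≤ closure (L ⊔ X)`.  B ED. 5's #2 line: ★ F3 ∘ ★ F2_qs ∘ this, modulo {EXH, TOP, MID}.
[cite: MoeglinWaldspurger1995, I.2.18, II.2.4, V.3.13] [cite: Rogawski1990, §13.3 p. 202; §13.9 p. 229] -/
theorem residualG_le_topologicalClosure_of_top_quasiSplit
    (𝔓 : (quasiSplit (↥(maximalRealSubfield L)) L (IsCMField.complexConj L) 3).ParabolicUnipotentData)
    (P : ClosedSubrep ((quasiSplit (↥(maximalRealSubfield L)) L (IsCMField.complexConj L) 3).rightRegular μq)) (hP : P.toContRep.IsTopIrreducible)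
    (hPres : P ≤ residualSubspace (quasiSplit (↥(maximalRealSubfield L)) L (IsCMField.complexConj L) 3) μq 𝔓)
    {ι : Type*} (Iso : ι → Submodule ℂ ((quasiSplit (↥(maximalRealSubfield L)) L (IsCMField.complexConj L) 3).L2 μq)) {β : ι → Type*}
    (Blk At Ln : ∀ i, β i → Submodule ℂ ((quasiSplit (↥(maximalRealSubfield L)) L (IsCMField.complexConj L) 3).L2 μq))
    {κ : Type*} (Bn : κ → ClosedSubrep ((quasiSplit (↥(maximalRealSubfield L)) L (IsCMField.complexConj L) 3).rightRegular μq))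
    (Atop : ClosedSubrep ((quasiSplit (↥(maximalRealSubfield L)) L (IsCMField.complexConj L) 3).rightRegular μq))
    (hAtop : Atop ≤ (quasiSplit (↥(maximalRealSubfield L)) L (IsCMField.complexConj L) 3).discreteSpectrum μq)
    (h1 : ∀ P' : DiscreteAutomorphicRep (quasiSplit (↥(maximalRealSubfield L)) L (IsCMField.complexConj L) 3) μq, P'.space ≤ Atop → P'.IsOneDimensional)
    (hD : P.toSubmodule ≤ (⨆ i, P.toSubmodule ⊓ Iso i).topologicalClosure)
    (hHead : ∀ i, ((quasiSplit (↥(maximalRealSubfield L)) L (IsCMField.complexConj L) 3).cuspidalSubspace μq 𝔓).toSubmoduleᗮ ⊓ Iso i ≤ (⨆ b, Blk i b).topologicalClosure)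
    (hEblk : ∀ i b, Blk i b ≤ (At i b ⊔ Ln i b).topologicalClosure)
    (hO : ∀ i, (⨆ b, At i b) ⟂ (⨆ b, Ln i b))
    (hN : ∀ i b, ∀ W : ClosedSubrep ((quasiSplit (↥(maximalRealSubfield L)) L (IsCMField.complexConj L) 3).rightRegular μq), W.toContRep.IsTopIrreducible →
      W ≤ residualSubspace (quasiSplit (↥(maximalRealSubfield L)) L (IsCMField.complexConj L) 3) μq 𝔓 → W.toSubmodule ⊓ Iso i ≤ (Ln i b)ᗮ)
    (hL : ∀ i b, At i b ≤ Atop.toSubmodule ⊔ ⨆ k, (Bn k).toSubmodule) :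
    P.toSubmodule ≤
      ((⨆ ψ : {ψ : ↥(TorusDict.torus (IsCMField.complexConj L)) →ₜ* ℂˣ // TorusDict.IsAutomorphic (IsCMField.complexConj L) ψ},
        (AdelicGroupData.AutomorphicCharacter.lineSubrep (𝒢 := (quasiSplit (↥(maximalRealSubfield L)) L (IsCMField.complexConj L) 3))
          (cmDetChar L 3 ((StdForm.antidiagonal 3).over L) ψ.1 ψ.2 ((Matrix.isUnit_iff_isUnit_det _).mp (StdForm.isUnit_over (StdForm.antidiagonal 3) L)).ne_zero) μq).toSubmodule) ⊔
        ⨆ k, (Bn k).toSubmodule).topologicalClosure := by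
  -- abbreviate the line lattice and the block span
  set Lns : Submodule ℂ ((quasiSplit (↥(maximalRealSubfield L)) L (IsCMField.complexConj L) 3).L2 μq) :=
    ⨆ ψ : {ψ : ↥(TorusDict.torus (IsCMField.complexConj L)) →ₜ* ℂˣ // TorusDict.IsAutomorphic (IsCMField.complexConj L) ψ},
      (AdelicGroupData.AutomorphicCharacter.lineSubrep (𝒢 := (quasiSplit (↥(maximalRealSubfield L)) L (IsCMField.complexConj L) 3))
        (cmDetChar L 3 ((StdForm.antidiagonal 3).over L) ψ.1 ψ.2 ((Matrix.isUnit_iff_isUnit_det _).mp (StdForm.isUnit_over (StdForm.antidiagonal 3) L)).ne_zero) μq).toSubmodule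
    with hLns
  set X : Submodule ℂ ((quasiSplit (↥(maximalRealSubfield L)) L (IsCMField.complexConj L) 3).L2 μq) := ⨆ k, (Bn k).toSubmodule with hX
  -- (TOP) puts the top atoms in `closure Lns`
  have htop : Atop.toSubmodule ≤ Lns.topologicalClosure :=
    le_topologicalClosure_iSup_lineSubrep_of_forall_isOneDimensional L μq Atop hAtop h1
  -- ★ LAYER 2 at `C := closure Lns ⊔ X`
  have hL' : ∀ i b, At i b ≤ Lns.topologicalClosure ⊔ X := fun i b => (hL i b).trans (sup_le_sup_right htop X)
  have h := residual_le_topologicalClosure_of_level_letters (quasiSplit (↥(maximalRealSubfield L)) L (IsCMField.complexConj L) 3) μq 𝔓 P hP hPres Iso Blk At Ln _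
    hD hHead hEblk hO hN hL'
  -- `closure (closure Lns ⊔ X) ≤ closure (Lns ⊔ X)`
  refine h.trans (Submodule.topologicalClosure_minimal _ ?_ (Submodule.isClosed_topologicalClosure _))
  exact sup_le ((Submodule.topologicalClosure_mono le_sup_left)) (le_sup_right.trans (Submodule.le_topologicalClosure _))

end QuasiSplit

end Summit.HodgeConjecture.HodgeConjecture.R90.S8

end
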